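import Mathlib
import HarnessLib
import HarnessLib.Audit
import Summits.CriticalPhenomena.Statement
import Literature.Probability.Percolation.LoopRepresentation
import Literature.Probability.Percolation.CLE6
import Literature.Probability.RandomPlanarGeometry.LoopWinding
import HarnessLib.Audit.Status.Attr

/-!
Route: CardyMagicRigidity

DORMANT since 2026-08-26T05:44:13Z (reconciler: no traction for 8.4 d (last activity item-evidence-added at 2026-08-17T20:00:00Z); parked, not closed — `ledger route dormant route-CriticalPhenomena-CardyMagicRigidity --off` to reactivat) — unstaffed, not closed; items shared with open routes are served there. `ledger route dormant <id> --off` reactivates.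

# Route CardyMagicRigidity — Magic-formula rigidity: the Gaussian cos(1/6)-nesting transform forces
bond-Z2 loops = site-T loops, hence Cardy

It suffices to show X = LoopLimitZ2EqT [full-plane loop universality ℤ² ~ 𝕋]: the full-plane
ensemble of
cluster-interface loops of critical bond percolation on δℤ² (DKKMO's typed unbased loop
configuration
`bondLoopConfig δ 0`) and that of critical site percolation on δ𝕋 (honeycomb interface loops
`IsSiteInterfaceLoop`/`siteLoopCurve`, typed by orientation) become indistinguishable as δ → 0⁺ in
DKKMO's
coupling distance d_CN (`LoopConfig.cnLawEDist` → 0). X → CardyFormulaZ2 because quad-crossing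
probabilities are
functionals of the full-plane loops up to boundary effects ("free boundary = no boundary", crux
LoopsToCrossings)
and Cardy's formula on 𝕋 is PROVED in the tree (`hasCrossingLimit_triDomainCrossingProb_holds`). The
route
realises card magic-formula-rigidity: X is reached not through a covariance upgrade but through the
2026 MAGIC
FORMULA (arXiv:2603.06268 Cor 10, crux MagicFormulaZ2): the cos_μ-twisted nesting transform
Λ_δ(f) = E[∏_loops 2cos(∫_int(ℓ) f + π/3)] of bond-ℤ² converges to the Gaussian functional
exp((3/4π²)∬ log|x−y| f(x)f(y)) for every bounded compactly supported density f with ∫f = 0; the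
same limit on
𝕋 (crux MagicFormulaT) plus the rigidity crux NestingRigidity (equal Gaussian transforms ⇒
d_CN-equal limits)
give X. So X = (MagicFormulaZ2 ∧ MagicFormulaT ∧ NestingRigidity)-consequence, and the target is
filed as rank 0.
Lean: `Filter.Tendsto (fun δ : ℝ ↦ Literature.Probability.RandomPlanarGeometry.LoopConfig.cnLawEDist
(Literature.Probability.Percolation.bondPercolation (Literature.Probability.LatticeModels.zdGraph 2)
Literature.Probability.Percolation.half) (Literature.Probability.Percolation.bondLoopConfig δ 0)
(Literature.Probability.LatticeModels.triSitePercolation Literature.Probability.Percolation.half)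
(fun cfg ↦ (⟨fun i ↦ {u : Literature.Probability.RandomPlanarGeometry.UnbasedLoop ℂ | ∃ (v :
Literature.Probability.LatticeModels.HexVertex) (γ :
Literature.Probability.LatticeModels.hexGraph.Walk v v),
Literature.Probability.Percolation.IsSiteInterfaceLoop cfg γ ∧ (i = 1 ↔ 0 <
Literature.Probability.Percolation.shoelace (γ.support.map
Literature.Probability.LatticeModels.hexCenter)) ∧ u =
Literature.Probability.RandomPlanarGeometry.UnbasedLoop.mk
(Literature.Probability.RandomPlanarGeometry.BasedLoop.mk
(Literature.Probability.Percolation.siteLoopCurve δ γ)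
(Literature.Probability.Percolation.isLoop_siteLoopCurve δ γ))}⟩ :
Literature.Probability.RandomPlanarGeometry.LoopConfig ℂ))) (nhdsWithin 0 (Set.Ioi 0)) (nhds 0)`

## Assembly
Deciding theorem `closes` (glue.lean, certified natively: conclusion `_root_.CardyFormulaZ2` by
name, hypotheses = the
nine items LoopLimitZ2EqT, MagicFormulaZ2, NestingRigidity, MagicFormulaT, LoopsToCrossings,
TransferContinuity,
SmirnovTri, Assembly, LoopLimitFromMagic; axioms propext / Classical.choice / Quot.sound). Pure
glue, self-contained (the Assembly, target and
TransferContinuity hypotheses are not invoked): the glue item LoopLimitFromMagic (= NestingRigidity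
applied to MagicFormulaZ2
and MagicFormulaT, over decl names; route-choice repair 2026-08-16, it makes the target the
conclusion of an item)
re-derives X inside the route; LoopsToCrossings gives bond − tri → 0 for every conformal rectangle;
SmirnovTri gives tri → F(η) for every
uniformizing datum; `Tendsto.add` + `sub_add_cancel` + `zero_add` give bond → F(η), i.e.
CardyFormulaZ2. SmirnovTri is
Smirnov's theorem on 𝕋 in the tree's own words (definitionally the Literature fact
`Literature.Probability.Percolation.hasCrossingLimit_triDomainCrossingProb`, PROVED in the tree as
`hasCrossingLimit_triDomainCrossingProb_holds`, file CardyFormulaConformalInvariance.lean): it is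
LISTED as a support item —
the fix the gate offers for the former unlisted assembly hypothesis (glue.extra-hypothesis) — rather
than imported, so that
the route file keeps the loop-vocabulary import closure (importing the proof module would add the ≈
210-module closure of
the whole Bollobás–Riordan Ch. 7 formalisation to the route's module cone); a prover closes it in
one line
(`theorem smirnovTri : SmirnovTri :=
Literature.Probability.Percolation.hasCrossingLimit_triDomainCrossingProb_holds`).
The Assembly item is restated over the listed items only, `MagicFormulaZ2 → MagicFormulaT →
NestingRigidity →
LoopsToCrossings → SmirnovTri → CardyFormulaZ2`, pure logic + Mathlib, provable now by the same five
lines (checked as an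
`example` in the planner sketch). Cone (route-repair 2026-08-15, re-checked 2026-08-16): the
used-constants cone of the nine items + closes is
vocabulary only (136 project constants; no cited closed fact without a `_holds`, no sorry,
whitelisted axioms;
`#h21_route_deps` in the sketch); none of the DKKMO / CLE₆ / FK-Ising named facts that ride in on
the modules defining
`bondLoopConfig`, `IsSiteInterfaceLoop`, `siteLoopCurve`, `UnbasedLoop.wind` is a hypothesis of any
item — needs-fact: none
(module-level artefact filed as refactor wi-21996: split the fact-free loop vocabulary out of those
modules).

Rationale: WHY THIS LINE. The one genuinely new theorem about bond-ℤ² geometry since DKKMO2020Rotational is the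
GFF convergence of the
six-vertex height function at Δ = −1/2 (arXiv:2603.06268 Thm 8) and its percolation corollary (Cor
10, via the
Baxter–Kelland–Wu identity eq. (3.2)): an infinite hierarchy of exact, scale-invariant identities
for the
nesting statistics of the FULL-PLANE ℤ² loop ensemble, with the universal constants μ = 1/6 and σ² =
3/π coming
from a Bethe-ansatz computation (Thms 14–15), not from conformal invariance. The card's mechanism is
to use this
transform as an IDENTIFICATION device: within CLE_κ the μ = 1/6 transform is Gaussian only for κ ∈
{3, 6} and
σ² separates them (Schramm–Sheffield–Wilson arXiv:math/0611687 nesting exponent: Δ₆(λ)+Δ₆(−λ) =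
3λ²/2π², checked
exactly against σ² = 3/π; the q = 2 point κ = 16/3, σ² = 8/3π is a theorem on both sides), and DKLM
themselves
transfer loop functionals along a KNOWN d_CN-universality (§5, p. 37: 𝕃(θ) → ℤ², "restrict to big
loops",
O(ε^c)); here the transfer is run in reverse — the functional is asked to FORCE universality ℤ² → 𝕋.
Areas
imported: integrable six-vertex/Bethe ansatz + GFF limits (arXiv:2603.06268), CLE nesting
integrability
(arXiv:math/0611687, arXiv:1401.0218, arXiv:2107.01788 imaginary-DOZZ three-point constants) for
MagicFormulaT,
DKKMO's coupling-metric technology (DKKMO2020Rotational) for ranks 0 and 5. Unlike CardyRotToConf /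
CardyViaSLE6 /
CardyUniqueLimit no covariance or conformal-invariance crux is filed, unlike CardyDiscreteHolo /
CardyHarmonicInvariants no observable is posited, unlike CardyIsoradial the anchor is named (site-𝕋)
and its
Cardy formula is already proved in the tree; the negatives index (stmt-CriticalPhenomena-0772, SAW)
is untouched.

RANKED CRUXES. #0 LoopLimitZ2EqT (target) — X: d_CN(full-plane loop configuration of bond
percolation on δℤ² at p = 1/2, full-plane loop configuration of site percolation on δ𝕋 at p = 1/2) →
0 as δ → 0⁺, both typed by orientation (type 1 = counter-clockwise = open/primal cluster inside), in
DKKMO's coupling distance `LoopConfig.cnLawEDist` (arXiv:2012.11672 eq. (2)). Card item: "full-plane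
hull ensemble of bond-ℤ² converges to CLE₆", in relative (𝕋-anchored) form so that no continuum
object is needed. [difficulty: open-problem] (why it might fail: This is full-plane universality
ℤ²~𝕋 (Schramm2007ICM Problem 2.11 class): false only if bond-ℤ² has a non-CLE₆ or non-unique loop
limit; as typed it also needs w.h.p. matching of microscopic loops (RSW density of small loops of
both types) and equal meshes.) [DKKMO2020Rotational, Schramm2007ICM, CamiaNewman2006,
arXiv:2603.06268]
#2 MagicFormulaZ2 (crux) — INPUT FACT (DKLM 2026, arXiv:2603.06268 Cor 10 at q = 1, special case of
densities): for every measurable bounded f : ℂ → ℝ supported in a ball with ∫ f = 0, the bond-ℤ²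
nesting transform Λ^ℤ²_δ(f) = E_(1/2)[∏ over all interface loops u of δℤ² of 2cos(∫_(wind(u,·)≠0) f
+ π/3)] tends, as δ → 0⁺, to exp((3/4π²) ∬ log‖x−y‖ f(x) f(y) dx dy) (= exp(−σ²/2 ∬ G_ℝ² f f) with
σ² = 3/π, G = −(1/2π)log, cos_μ(x) = cos(x+π/3)/cos(π/3), μ = 1/6). Interior = points of non-zero
winding number (equals the interior of the rounded simple loop). Filed first per the plancard rule:
the mechanism rests on this unproved-in-Lean named fact; a cite request is filed; provers should not
attempt it — it lands as a Literature fact and is consumed as the first hypothesis of the assembly.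
[difficulty: XL] (why it might fail: Not provable here and not yet refereed: arXiv:2603.06268 (2026
preprint, margin comments still in source) rests on the unreleased companion [magicformula]; the
Lean rendering (winding-number interior, f ∈ L∞_c with ∫f=0, finprod over all loops, Bochner
integral) may mismatch Cor 10.) [arXiv:2603.06268, DKKMO2020Rotational]
#3 NestingRigidity (crux) — Nesting rigidity, relative form (card item M1 + M3, honest version): IF
the bond-ℤ² and the site-𝕋 nesting transforms both converge, for every admissible f, to the Gaussian
functional exp((3/4π²)∬ log‖x−y‖ f f) (i.e. the statements of MagicFormulaZ2 and MagicFormulaT),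
THEN X = LoopLimitZ2EqT. Content: tightness of both families in d_CN, continuity of Λ along
d_CN-convergent RSW sequences ("restrict to big loops", arXiv:2603.06268 p. 37), and injectivity of
the μ = 1/6 transform on the class of subsequential limits (E(2)-invariant by DKKMO, ergodic,
positive-area interiors, percolation-Markov). Hardest open step of the line. [deps: MagicFormulaZ2,
MagicFormulaT, LoopLimitZ2EqT] [difficulty: open-problem] (why it might fail: Λ is LINEAR in the law
(level sets convex) and per point-configuration pins the nesting-pattern PGF only on an ellipse arc;
no injectivity mechanism is known without extra structure (ergodicity, positive-area interiors,
Markov property, E(2)-invariance) — may be as hard as conformal invariance.) [arXiv:2603.06268,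
arXiv:math/0611687, arXiv:1401.0218, arXiv:1401.0217, SheffieldWerner2012, CamiaNewman2006,
arXiv:2107.01788]
#4 MagicFormulaT (crux) — Continuum magic formula in lattice clothing (card item M2, honeycomb/𝕋
version): for every admissible f the site-𝕋 nesting transform Λ^𝕋_δ(f) = E_(1/2)[∏ over all
honeycomb interface loops u of δ𝕋 of 2cos(∫_(wind(u,·)≠0) f + π/3)] tends to the SAME Gaussian
functional exp((3/4π²)∬ log‖x−y‖ f f). Equivalent (given Camia–Newman's full-plane CLE₆ limit and
continuity of Λ) to: the e^(±iπ/3)-twisted nesting field of full-plane CLE₆ is a free field with σ²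
= 3/π at all orders ("bosonisation of CLE₆ is exact"); two-point order is SSW's theorem, three
points is imaginary-DOZZ territory (arXiv:2107.01788), n ≥ 4 open. Necessary for X given
MagicFormulaZ2 (support TransferContinuity), hence also the route's sharpest falsifiable prediction.
[difficulty: XL] (why it might fail: True iff universality holds (given rank 2 +
TransferContinuity); an independent proof needs ALL-order twisted CLE₆ nesting = free field (only
≤3-point CLE integrability is in print, arXiv:2107.01788, simple-CLE range) or a complex-weight
height mapping for the honeycomb O(1) model.) [CamiaNewman2006, arXiv:math/0611687,
arXiv:2107.01788, arXiv:1401.0218, Nienhuis1982, arXiv:2603.06268]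
#5 LoopsToCrossings (crux) — Loop universality ⇒ crossing universality (card item M4, "free boundary
= full plane"): X → for every conformal rectangle R, bondDomainCrossingProb R δ −
triDomainCrossingProb R δ → 0 as δ → 0⁺ (G02 discretisations on both lattices, same mesh). The
crossing event of Ω_δ is an event of the full-plane configuration and is detected by macroscopic
loops up to boundary effects; d_CN-closeness of the two loop laws then transfers crossing
probabilities (the d_SS half of DKKMO Thm 1.2, GPS §2.3–2.4, Camia–Newman §5–6), using RSW,
half-plane 3-arm and 5-arm bounds on both lattices. [deps: LoopLimitZ2EqT] [difficulty: L] (why it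
might fail: Quad crossings are loop-measurable only up to boundary effects: needs half-plane 3-arm /
5-arm bounds near G02's discrete arcs on BOTH lattices, and inherits the degenerate-arc risk for
wild Jordan boundaries (CardyUniqueLimit NegDegenerateArcs, stmt-CriticalPhenomena-0748).)
[DKKMO2020Rotational, SchrammSmirnov2011, CamiaNewman2006, arXiv:1008.1378, Smirnov2001]
#9 TransferContinuity (support) — The converse tool (arXiv:2603.06268 §5 p. 37 run between ℤ² and
𝕋): X → for every admissible f, Λ^ℤ²_δ(f) − Λ^𝕋_δ(f) → 0 ("restrict to big loops" with O(ε^c) error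
by RSW on both lattices, uniform integrability of the unbounded product |∏| ≤ 2^N from
super-exponential nesting tails, then couple). With MagicFormulaZ2 it makes MagicFormulaT NECESSARY
for X, so a refutation of rank 4 refutes loop universality; it is also the continuity half of the
foreseen split of rank 3. [difficulty: M] [arXiv:2603.06268, DKKMO2020Rotational]
#9 SmirnovTri (support) — Smirnov's theorem on 𝕋 in the tree's words: for every conformal rectangle
R, triDomainCrossingProb R δ → cardyFunction (crossRatio x) for every uniformizing datum;
definitionally the PROVED Literature fact hasCrossingLimit_triDomainCrossingProb (…_holds), listed
instead of imported to keep the route's import cone small; one-line proof. [difficulty: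
provable-now] [Smirnov2001, BollobasRiordan2006]
#9 LoopLimitFromMagic (support, glue; route-choice repair 2026-08-16) — MagicFormulaZ2 →
MagicFormulaT → NestingRigidity → LoopLimitZ2EqT over the route's decl names: the item that
CONCLUDES the target (the gate's target-reachability requirement; NestingRigidity states the same
implication with the three bodies inlined, which the item graph cannot see). No content of its own —
provable now by unfolding, `fun h2 h4 h3 => h3 h2 h4`; the deciding theorem derives X through it.
[difficulty: provable-now] [arXiv:2603.06268]

TWO-LAYER PLAN. NestingRigidity ⇐ C1 → C2 → C3 → NestingRigidity with: C1 CNPrecompactness (both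
lattice families are precompact
as laws on the d_CN-completion of locally finite loop configurations; subsequential limits are
E(2)-invariant
[dkkmo_rotation_invariance for ℤ²], ergodic, RSW, with positive-area interiors) — needs definition
D1;
C2 TransformLimit (the continuum transform Λ_P(f) := lim_ε E_P[∏_(diam ≥ ε) cos_μ(∫_int f)] exists
on that class
and Λ_δ → Λ_P along convergent subsequences; lattice shadow = TransferContinuity) — needs D2; C3
ContinuumInjectivity (card M1 proper: on that class, Λ_P = Gaussian(σ² = 3/π, μ = 1/6) for all
admissible f ⇒ P
is the Camia–Newman full-plane CLE₆ law) — needs D1/D3. MagicFormulaT ⇐ T1 → T2 → MagicFormulaT with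
T1 CLE₆
bosonisation (all-order twisted nesting of full-plane CLE₆ is the free field: extend SSW/ACSW beyond
three
points, or an imaginary-geometry/LQG argument), T2 Camia–Newman full-plane convergence
(CamiaNewman2006 Thm 6;
tree fact exists_isCNLFamily_tendsto is the domain version) + C2. LoopsToCrossings ⇐ L1 (quad
crossings of
conformal rectangles are ε-stable loop functionals on ℤ², boundary arm bookkeeping for G02's
discreteCrossing) →
L2 (same on 𝕋 for triCrossing) → glue through X. Nothing here is filed now.

KILL CRITERIA. (i) ¬MagicFormulaT (a certified deviation of the 𝕋 transform from the Gaussian for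
one admissible f — Monte
Carlo first, then an exact CLE₆ nesting computation) closes the route (close --reason
refuted:MagicFormulaT) AND,
through MagicFormulaZ2 + TransferContinuity, refutes X = loop universality ℤ²~𝕋: report to the
operator, every
Cardy route is affected. (ii) A counterexample to continuum injectivity on the natural class (two
distinct
E(2)-invariant ergodic RSW-type loop laws with positive-area interiors and identical μ = 1/6
transforms) kills
the intended proof of NestingRigidity (not the typed implication): pivot = restate rank 3 with an
explicit
conformal-invariance hypothesis, which merges the line into CardyRotToConf r2 — then close --reason
superseded
--by route-CriticalPhenomena-CardyRotToConf unless C1/C2 have independent value. (iii)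
¬LoopsToCrossings can only
come from a boundary degeneracy of G02's discretisation (cf. NegDegenerateArcs): statement-hygiene
report, not a
refutation of the line. (iv) If SLE6LimitZ2 / CardyFormulaZ2 is proved by a sibling route first,
this route is
moot for the conjunct but X (full-plane CLE₆ for bond-ℤ²) keeps independent value. (v) Withdrawal or
material
correction of arXiv:2603.06268 Cor 10 at q = 1 closes the route outright.

NOT DECOMPOSED YET. The axioms of the class of subsequential limits (exactly which of:
E(2)-invariance, ergodicity/mixing,
local finiteness, non-crossing, positive-area interiors, annulus RSW,
percolation-Markov/independence are needed
by C3 — degenerate "needle" loops with null interiors are invisible to Λ, so positive area is not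
optional); the
topology/σ-algebra carrying full-plane loop laws (D1); measurability and uniform integrability of
the lattice
transform (|∏| ≤ 2^N with N the number of loops meeting supp f; super-exponential nesting tails);
whether
densities f ∈ L∞_c suffice or DKLM's finite-energy signed measures are needed for rigidity; the
boundary
bookkeeping and rates of rank 5; mesh conventions (edge length δ on ℤ² vs site spacing δ on 𝕋 —
immaterial in
the limit by scale invariance of the Gaussian functional, ∬ log|x−y| f_r f_r = ∬ log|x−y| f f when ∫
f = 0).

CHEAPEST FALSIFIER. Monte-Carlo test of MagicFormulaT against MagicFormulaZ2 and the Gaussian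
(refuters, kit): site percolation on 𝕋
and bond percolation on ℤ² in a box of 1024 mesh units, f = λ(1_A/|A| − 1_B/|B|) for two discs of
radius 24 at
centre distance 256, λ ∈ {1/2, 1, 3/2, 2}; extract all interface loops meeting A ∪ B, interiors by
winding number,
estimate log Λ_δ(f) on both lattices (10⁴ samples each) and compare (a) ℤ² vs 𝕋 (TransferContinuity
+ X predict
equality up to finite-size effects), (b) both vs (3/4π²)·Q(f), Q(f) = λ²(2q_AA − 2q_AB) with q
computed by
quadrature; non-Gaussianity shows as a λ⁴ term in log Λ. Not run here (one-shot planner unit; no kit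
job
submitted). Already run by hand and PASSED: the two-point exponent check at κ = 6 (SSW: Δ₆(λ)+Δ₆(−λ)
= 3λ²/2π² =
σ²λ²/2π with σ² = 3/π exactly; linear terms cancel by charge neutrality) and the q = 2 calibration
(κ = 16/3,
μ = 1/8, σ² = 8/3π: 4λ²/3π² on both sides, both theorems). Second desk check for a refuter:
specialise the
non-simple-CLE imaginary-DOZZ three-point nesting constant (sequel of arXiv:2107.01788 for κ ∈
(4,8)) to the
magic charges and verify it factorises to the free-field value.

NUMBERS. μ = arccos(√q/2)/2π = 1/6 at q = 1; cos_μ(x) = cos(x+π/3)/cos(π/3) = 2cos(x+π/3) = cos x −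
√3 sin x (not even:
the asymmetry is the background charge at ∞). σ² = 2/arccos(−√q/2) = 3/π at q = 1 (arXiv:2603.06268
Thm 8 / Cor
10; = 1/arcsin(c/2), c = √3, Δ = −1/2). Gaussian functional: exp(−σ²/2 ∬ G f f), G(x,y) = −(1/2π)
log|x−y| ⇒
exponent +3/(4π²) ∬ log|x−y| f(x) f(y). SSW (arXiv:math/0611687) at κ = 6: w = 2cos(λ+π/3) ⇒ Δ₆(λ) =
3λ²/4π² +
λ/2π, Δ₆(λ)+Δ₆(−λ) = 3λ²/2π² = two-point Gaussian exponent. κ = 3 with the same twist: 3λ²/4π² (σ² =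
3/2π) —
Gaussian at two points but excluded by σ². q = 2: κ = 16/3, μ = 1/8, σ² = 8/(3π), Δ(λ)+Δ(−λ) =
4λ²/3π²
(KemppainenSmirnov2017 + arXiv:2603.06268 at c = √(2+√2): both sides theorems). Percolation
three-point
connectivity constant ≈ 1.022 (Delfino–Viçi; arXiv:2107.01788 §1.4) — the imaginary-DOZZ value a T1
computation
must be consistent with.

DEFINITION REQUESTS. D1 (Literature/Probability/RandomPlanarGeometry): `LocFinLoopConfig` — the
d_CN-completion / Polish structure on
locally finite non-crossing typed loop configurations (DKKMO arXiv:2012.11672 §1.2) with Borel laws,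
so that
subsequential limits of `bondLoopConfig δ 0` and of the 𝕋 configuration exist as probability
measures and
`cnLawEDist` metrises their convergence (for C1–C3). D2 (same topic): `nestingTransform P f` :=
lim_(ε→0)
E_P[∏_(diam ℓ ≥ ε) 2cos(∫_(wind ≠ 0) f + π/3)] for a law P on D1 (for C2/C3; Miller–Watson–Wilson
arXiv:1401.0218
is the centring model). D3 (Literature/Probability/Percolation): `fullPlaneCNLLaw` — the full-plane
Camia–Newman
CLE₆ law as the d_CN-limit of the site-𝕋 configurations (CamiaNewman2006 Thm 6), to state C3
absolutely.
Cite request: fact "DKLM2026 Cor 10" (arXiv:2603.06268 Corollary 10, q ∈ [1,4],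
finite-Dirichlet-energy
generalized test functions) as a Literature named fact in Literature/Probability/Percolation (family
crit-ising),
of which MagicFormulaZ2 is the q = 1, density special case.

Novelty: Searches (2026-08-15): full read of arXiv:2603.06268 pp. 9–16 (Defs 3–7, Thm 8, Cor 10 p. 13, Thms
11–15) and
§5 p. 37 (the transfer of loop functionals along the 𝕃(θ)→ℤ² universality, "restrict to big loops");
arXiv:2107.01788 pp. 2–8 (ACSW: CLE three-point nesting = imaginary DOZZ, simple CLE; κ∈(4,8)
announced; IJS
interpretation; n ≥ 4 points open); `lit search --source zbmath "conformal loop ensemble nesting"`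
(7 hits:
arXiv:1401.0217, arXiv:1401.0218, arXiv:1605.02239, arXiv:2107.01788, arXiv:2204.09905, …),
`"imaginary DOZZ
conformal loop ensemble"` (2: arXiv:2107.01788, arXiv:2409.16547), `"backbone exponent percolation
Nolin Qian
Sun Zhuang"` (3: arXiv:2309.05050, arXiv:2410.06419, arXiv:2410.04767 — the LQG/CLE-integrability
school now
computing percolation constants); `lit galaxy search "conformal loop ensemble nesting field" --star
all` and
`"six-vertex model Gaussian free field" --star all` and a long-phrase variant (0 hits each;
pdf/crabby stars
timed out); local hybrid searchd unavailable (connection reset, 3 tries), arXiv/OpenAlex/S2 APIs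
429;
`lean search` for 2603.06268 / magic formula / six-vertex in Literature (0 decls: the fact is not
vendored);
the six sibling Theses files and all 125 CardyFormulaZ2 card titles (none uses the magic formula as
an
identification device; boundary-dklm-coulomb-gas uses the same 2026 theorem for a BOUNDARY twist,
explicitly
the opposite strategy; ik-isotropic-cle6-transport / cylinder-exp-covariance are
transport/covariance l  [refs: 2603.06268, 2107.01788, 1401.0217, 1401.0218, 1605.02239, 2204.09905, 2409.16547, 2309.05050, 2410.06419, 2410.04767, math/0611687, SheffieldWerner2012]

Barriers (technique_class: transform-injectivity, nesting-statistics, universality): - technique_class: transform-injectivity, nesting-statistics, universality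
- Literature.Barriers.CriticalPhenomena.EmbeddingModulusUniqueness: evaded — the inputs see the
embedding: σ² = 3/π (Bethe ansatz at the ISOTROPIC weights a = b = 1, c = √3) and
dkkmo_rotation_invariance are exactly evasion (i) of the barrier; for an axis-stretched ℤ² the
transform is Gaussian for the sheared Dirichlet form and rank 3 would return the sheared CLE₆, so
Beffara's dichotomy is respected, not contradicted.
- Literature.Barriers.CriticalPhenomena.SmirnovTriangularOnly: outside the class — no
separating-probability triple, no colour switching, no discrete contour integral on ℤ²; Smirnov's
theorem enters only on 𝕋, as the proved anchor hasCrossingLimit_triDomainCrossingProb_holds.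
- Literature.Barriers.CriticalPhenomena.CoveringLatticeShift: outside the class — no model
interpolation, no Russo formula, no type-II/III pairing.
- Literature.Barriers.CriticalPhenomena.FKParafermionicHalfCauchyRiemann: outside the class — no
parafermionic or any other discrete-holomorphic observable; the only exact lattice input is the BKW
identity eq. (3.2) of arXiv:2603.06268, an identity between expectations, not a half-Cauchy–Riemann
relation.
- Literature.Barriers.CriticalPhenomena.ScaleCovarianceNotMoebius: applies in spirit (symmetry data
alone do not identify a limit): the line does not upgrade symmetries; identification is by an
explicit transform identity, and the missing rigidity is named as crux Nesti

History (route lifecycle, newest last):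
- 2026-08-15T16:37:45Z · rev 1: restated Assembly (stmt-CriticalPhenomena-4839) — route-repair (glue): deciding theorem `closes` supplied (glue.lean; seven items → _root_.CardyFormulaZ2, self-contained glue; Smirnov's theorem used inside the (planner-rbadge-CriticalPhenomena-CardyMagicRig-a54e07cf-g4-0)
- 2026-08-16T03:50:10Z · AUTO-CRUX (backfill): LoopLimitZ2EqT — hypotheses of the deciding theorem that nothing in the route derives are cruxes (operator:999:586464)
- 2026-08-26T05:44:13Z · DORMANT — reconciler: no traction for 8.4 d (last activity item-evidence-added at 2026-08-17T20:00:00Z); parked, not closed — `ledger route dormant route-CriticalPhenomen (operator:999:873500)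

sub-problem: CardyFormulaZ2 · status: dormant · opened planner-plancard-CriticalPhenomena-CardyFormu-bd395679-0 2026-08-15T11:35:13Z · rev 4 · ledger route-CriticalPhenomena-CardyMagicRigidity
GENERATED by the gate from the ledger (D-0016/17). Provers cite these decls: `theorem foo : Summit.CriticalPhenomena.CardyFormulaZ2.Theses.CardyMagicRigidity.<Decl> := …` in Summits/CriticalPhenomena/CardyFormulaZ2/Theorems/<Name>.lean.
-/

namespace Summit.CriticalPhenomena.CardyFormulaZ2.Theses.CardyMagicRigidity

open scoped BigOperators Topology Manifold Classical MeasureTheory ProbabilityTheory Matrix InnerProductSpace ComplexConjugate ContinuousMap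
open Filter Set Function TopologicalSpace MeasureTheory

attribute [summit_statement] _root_.CardyFormulaZ2

/-- item stmt-CriticalPhenomena-4833 · crux (kind.auto-crux: conjecture-grade) · rank 0 · open · by planner
why it might fail: Full-plane loop universality ℤ²~𝕋 is open (Schramm2007ICM Prob. 2.11 class; DKKMO prove rotation invariance only): false iff bond-ℤ² has a non-CLE₆ or non-unique subsequential d_CN limit; as typed it also needs dense microscopic loops of BOTH types at scales ≪ ε on both lattices (finite energy).
sources: DKKMO2020Rotational, Schramm2007ICM, CamiaNewman2006, arXiv:1008.1378, arXiv:2603.06268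
[target] X: d_CN(full-plane loop configuration of bond percolation on δℤ² at p = 1/2, full-plane
loop configuration of site percolation on δ𝕋 at p = 1/2) → 0 as δ → 0⁺, both typed by orientation
(type 1 = counter-clockwise = open/primal cluster inside), in DKKMO's coupling distance
`LoopConfig.cnLawEDist` (arXiv:2012.11672 eq. (2)). Card item: "full-plane hull ensemble of bond-ℤ²
converges to CLE₆", in relative (𝕋-anchored) form so that no continuum object is needed.
[difficulty: open-problem] -/
@[route_item "route-CriticalPhenomena-CardyMagicRigidity", crux]
def LoopLimitZ2EqT : Prop :=
  Filter.Tendsto (fun δ : ℝ ↦ Literature.Probability.RandomPlanarGeometry.LoopConfig.cnLawEDist (Literature.Probability.Percolation.bondPercolation (Literature.Probability.LatticeModels.zdGraph 2) Literature.Probability.Percolation.half) (Literature.Probability.Percolation.bondLoopConfig δ 0) (Literature.Probability.LatticeModels.triSitePercolation Literature.Probability.Percolation.half) (fun cfg ↦ (⟨fun i ↦ {u : Literature.Probability.RandomPlanarGeometry.UnbasedLoop ℂ | ∃ (v : Literature.Probability.LatticeModels.HexVertex) (γ : Literature.Probability.LatticeModels.hexGraph.Walk v v), Literature.Probability.Percolation.IsSiteInterfaceLoop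 cfg γ ∧ (i = 1 ↔ 0 < Literature.Probability.Percolation.shoelace (γ.support.map Literature.Probability.LatticeModels.hexCenter)) ∧ u = Literature.Probability.RandomPlanarGeometry.UnbasedLoop.mk (Literature.Probability.RandomPlanarGeometry.BasedLoop.mk (Literature.Probability.Percolation.siteLoopCurve δ γ) (Literature.Probability.Percolation.isLoop_siteLoopCurve δ γ))}⟩ : Literature.Probability.RandomPlanarGeometry.LoopConfig ℂ))) (nhdsWithin 0 (Set.Ioi 0)) (nhds 0)

/-- item stmt-CriticalPhenomena-4835 · crux · rank 3 · open · by planner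
why it might fail: Λ_P(f)=E_P[∏cos_μ(∫_int f)] is LINEAR in the law P ({Λ_P ≡ Gaussian} is convex) and per configuration pins nesting data only on an arc; no injectivity theorem for nesting transforms exists (MWW arXiv:1401.0218 go law→field only); the E(2)/ergodic/Markov input may cost as much as CI.
sources: arXiv:2603.06268, arXiv:1401.0218, arXiv:1401.0217, arXiv:math/0611687, SheffieldWerner2012, CamiaNewman2006
[crux] Nesting rigidity, relative form (card item M1 + M3, honest version): IF the bond-ℤ² and the
site-𝕋 nesting transforms both converge, for every admissible f, to the Gaussian functional
exp((3/4π²)∬ log‖x−y‖ f f) (i.e. the statements of MagicFormulaZ2 and MagicFormulaT), THEN X =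
LoopLimitZ2EqT. Content: tightness of both families in d_CN, continuity of Λ along d_CN-convergent
RSW sequences ("restrict to big loops", arXiv:2603.06268 p. 37), and injectivity of the μ = 1/6
transform on the class of subsequential limits (E(2)-invariant by DKKMO, ergodic, positive-area
interiors, percolation-Markov). Hardest open step of the line. [deps: MagicFormulaZ2, MagicFormulaT,
LoopLimitZ2EqT] [difficulty: open-problem] -/
@[route_item "route-CriticalPhenomena-CardyMagicRigidity", crux]
def NestingRigidity : Prop :=
  (∀ (f : ℂ → ℝ) (R C : ℝ), Measurable f → (∀ z, |f z| ≤ C) → (∀ z, R < ‖z‖ → f z = 0) → ∫ z, f z = 0 → Filter.Tendsto (fun δ : ℝ ↦ ∫ cfg, (∏ᶠ u ∈ ((Literature.Probability.Percolation.bondLoopConfig δ 0 cfg).F 0 ∪ (Literature.Probability.Percolation.bondLoopConfig δ 0 cfg).F 1), 2 * Real.cos ((∫ z in {z : ℂ | u.wind z ≠ 0}, f z) + Real.pi / 3)) ∂(Literature.Probability.Percolation.bondPercolation (Literature.Probability.LatticeModels.zdGraph 2) Literature.Probability.Percolation.half)) (nhdsWithin 0 (Set.Ioi 0)) (nhds (Real.exp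 (3 / (4 * Real.pi ^ 2) * ∫ x, ∫ y, Real.log ‖x - y‖ * f x * f y)))) → (∀ (f : ℂ → ℝ) (R C : ℝ), Measurable f → (∀ z, |f z| ≤ C) → (∀ z, R < ‖z‖ → f z = 0) → ∫ z, f z = 0 → Filter.Tendsto (fun δ : ℝ ↦ ∫ cfg, (∏ᶠ u ∈ {u : Literature.Probability.RandomPlanarGeometry.UnbasedLoop ℂ | ∃ (v : Literature.Probability.LatticeModels.HexVertex) (γ : Literature.Probability.LatticeModels.hexGraph.Walk v v), Literature.Probability.Percolation.IsSiteInterfaceLoop cfg γ ∧ u = Literature.Probability.RandomPlanarGeometry.UnbasedLoop.mk (Literature.Probability.RandomPlanarGeometry.BasedLoop.mk (Literature.Probability.Percolation.siteLoopCurve δ γ) (Literature.Probability.Percolation.isLoop_siteLoopCurve δ γ))}, 2 * Real.cos ((∫ z in {z : ℂ | u.wind z ≠ 0}, f z) + Real.pi / 3)) ∂(Literature.Probability.LatticeModels.triSitePercolation Literature.Probability.Percolation.half)) (nhdsWithin 0 (Set.Ioi 0)) (nhds (Real.exp (3 / (4 * Real.pi ^ 2) * ∫ x, ∫ y, Real.log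 ‖x - y‖ * f x * f y)))) → Filter.Tendsto (fun δ : ℝ ↦ Literature.Probability.RandomPlanarGeometry.LoopConfig.cnLawEDist (Literature.Probability.Percolation.bondPercolation (Literature.Probability.LatticeModels.zdGraph 2) Literature.Probability.Percolation.half) (Literature.Probability.Percolation.bondLoopConfig δ 0) (Literature.Probability.LatticeModels.triSitePercolation Literature.Probability.Percolation.half) (fun cfg ↦ (⟨fun i ↦ {u : Literature.Probability.RandomPlanarGeometry.UnbasedLoop ℂ | ∃ (v : Literature.Probability.LatticeModels.HexVertex) (γ : Literature.Probability.LatticeModels.hexGraph.Walk v v), Literature.Probability.Percolation.IsSiteInterfaceLoop cfg γ ∧ (i = 1 ↔ 0 < Literature.Probability.Percolation.shoelace (γ.support.map Literature.Probability.LatticeModels.hexCenter)) ∧ u = Literature.Probability.RandomPlanarGeometry.UnbasedLoop.mk (Literature.Probability.RandomPlanarGeometry.BasedLoop.mk (Literature.Probability.Percolation.siteLoopCurve δ γ) (Literature.Probability.Percolation.isLoop_siteLoopCurve δ γ))}⟩ : Literature.Probability.RandomPlanarGeometry.LoopConfig ℂ))) (nhdsWithin 0 (Set.Ioi 0)) (nhds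 0)

/-- item stmt-CriticalPhenomena-4836 · crux · rank 4 · open · by planner
why it might fail: No independent proof in print: needs ALL-order twisted CLE₆ nesting = GFF (only ≤3-point CLE nesting integrability: SSW math/0611687, imaginary DOZZ arXiv:2107.01788) or a DKLM-type Bethe-ansatz GFF theorem for honeycomb O(1) (solvable, Baxter 1986; no GFF result); false iff ℤ²~𝕋 universality fails.
sources: CamiaNewman2006, arXiv:math/0611687, arXiv:2107.01788, arXiv:1401.0218, Nienhuis1982, doi:10.1088/0305-4470/19/14/019
[crux] Continuum magic formula in lattice clothing (card item M2, honeycomb/𝕋 version): for every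
admissible f the site-𝕋 nesting transform Λ^𝕋_δ(f) = E_(1/2)[∏ over all honeycomb interface loops u
of δ𝕋 of 2cos(∫_(wind(u,·)≠0) f + π/3)] tends to the SAME Gaussian functional exp((3/4π²)∬ log‖x−y‖
f f). Equivalent (given Camia–Newman's full-plane CLE₆ limit and continuity of Λ) to: the
e^(±iπ/3)-twisted nesting field of full-plane CLE₆ is a free field with σ² = 3/π at all orders
("bosonisation of CLE₆ is exact"); two-point order is SSW's theorem, three points is imaginary-DOZZ
territory (arXiv:2107.01788), n ≥ 4 open. Necessary for X given MagicFormulaZ2 (support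
TransferContinuity), hence also the route's sharpest falsifiable prediction. [difficulty: XL] -/
@[route_item "route-CriticalPhenomena-CardyMagicRigidity", crux]
def MagicFormulaT : Prop :=
  ∀ (f : ℂ → ℝ) (R C : ℝ), Measurable f → (∀ z, |f z| ≤ C) → (∀ z, R < ‖z‖ → f z = 0) → ∫ z, f z = 0 → Filter.Tendsto (fun δ : ℝ ↦ ∫ cfg, (∏ᶠ u ∈ {u : Literature.Probability.RandomPlanarGeometry.UnbasedLoop ℂ | ∃ (v : Literature.Probability.LatticeModels.HexVertex) (γ : Literature.Probability.LatticeModels.hexGraph.Walk v v), Literature.Probability.Percolation.IsSiteInterfaceLoop cfg γ ∧ u = Literature.Probability.RandomPlanarGeometry.UnbasedLoop.mk (Literature.Probability.RandomPlanarGeometry.BasedLoop.mk (Literature.Probability.Percolation.siteLoopCurve δ γ) (Literature.Probability.Percolation.isLoop_siteLoopCurve δ γ))}, 2 * Real.cos ((∫ z in {z : ℂ | u.wind z ≠ 0}, f z) + Real.pi / 3)) ∂(Literature.Probability.LatticeModels.triSitePercolation Literature.Probability.Percolation.half)) (nhdsWithin 0 (Set.Ioi 0)) (nhds (Real.exp (3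 / (4 * Real.pi ^ 2) * ∫ x, ∫ y, Real.log ‖x - y‖ * f x * f y)))

/-- item stmt-CriticalPhenomena-4837 · crux · rank 5 · closed · proved by Summit.CriticalPhenomena.CardyFormulaZ2.Cruxes.LoopsToCrossings.OracleSandwich.LoopsToCrossings_of (prover) · by planner
why it might fail: Quad crossings are only a.s.-measurable, not continuous, in the loop limit (CamiaNewman2006 after Thm 7; GPS arXiv:1008.1378 Prop 5 leans on the 𝕋 exploration path's own convergence, absent on ℤ²): needs discrete stability of loop-arc assembly; as typed ∀ Jordan R inherits arc degeneracy (stmt-0748)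
sources: CamiaNewman2006, arXiv:1008.1378, DKKMO2020Rotational, SchrammSmirnov2011, Smirnov2001
[crux] Loop universality ⇒ crossing universality (card item M4, "free boundary = full plane"): X →
for every conformal rectangle R, bondDomainCrossingProb R δ − triDomainCrossingProb R δ → 0 as δ →
0⁺ (G02 discretisations on both lattices, same mesh). The crossing event of Ω_δ is an event of the
full-plane configuration and is detected by macroscopic loops up to boundary effects; d_CN-closeness
of the two loop laws then transfers crossing probabilities (the d_SS half of DKKMO Thm 1.2, GPS
§2.3–2.4, Camia–Newman §5–6), using RSW, half-plane 3-arm and 5-arm bounds on both lattices. [deps: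
LoopLimitZ2EqT] [difficulty: L] -/
@[route_item "route-CriticalPhenomena-CardyMagicRigidity", crux]
def LoopsToCrossings : Prop :=
  (Filter.Tendsto (fun δ : ℝ ↦ Literature.Probability.RandomPlanarGeometry.LoopConfig.cnLawEDist (Literature.Probability.Percolation.bondPercolation (Literature.Probability.LatticeModels.zdGraph 2) Literature.Probability.Percolation.half) (Literature.Probability.Percolation.bondLoopConfig δ 0) (Literature.Probability.LatticeModels.triSitePercolation Literature.Probability.Percolation.half) (fun cfg ↦ (⟨fun i ↦ {u : Literature.Probability.RandomPlanarGeometry.UnbasedLoop ℂ | ∃ (v : Literature.Probability.LatticeModels.HexVertex) (γ : Literature.Probability.LatticeModels.hexGraph.Walk v v), Literature.Probability.Percolation.IsSiteInterfaceLoop cfg γ ∧ (i = 1 ↔ 0 < Literature.Probability.Percolation.shoelace (γ.support.map Literature.Probability.LatticeModels.hexCenter)) ∧ u = Literature.Probability.RandomPlanarGeometry.UnbasedLoop.mk (Literature.Probability.RandomPlanarGeometry.BasedLoop.mk (Literature.Probability.Percolation.siteLoopCurve δ γ) (Literature.Probability.Percolation.isLoop_siteLoopCurve δ γ))}⟩ :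 Literature.Probability.RandomPlanarGeometry.LoopConfig ℂ))) (nhdsWithin 0 (Set.Ioi 0)) (nhds 0)) → ∀ R : Literature.Probability.RandomPlanarGeometry.ConformalRectangle, Filter.Tendsto (fun δ : ℝ ↦ Literature.Probability.Percolation.bondDomainCrossingProb R δ - Literature.Probability.Percolation.triDomainCrossingProb R δ) (nhdsWithin 0 (Set.Ioi 0)) (nhds 0)

-- `LoopsToCrossings` holds: proved by `Summit.CriticalPhenomena.CardyFormulaZ2.Cruxes.LoopsToCrossings.OracleSandwich.LoopsToCrossings_of` (its module imports this route file, so no `_holds` link can be stated here).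

/-- item stmt-CriticalPhenomena-4834 · support · rank 2 · open · by planner
why it might fail: Provenance only: arXiv:2603.06268 is a 2026 preprint (margin comments in source) whose Thm 8 ⇒ Cor 10 imports k-point rotation invariance (Thm 12) from the unreleased companion [magicformula]; no mathematical or transcription defect found.
sources: DuminilCopinKozlowskiLammersManolescu2026, arXiv:2603.06268, DKKMO2020Rotational
[crux] INPUT FACT (DKLM 2026, arXiv:2603.06268 Cor 10 at q = 1, special case of densities): for
every measurable bounded f : ℂ → ℝ supported in a ball with ∫ f = 0, the bond-ℤ² nesting transform
Λ^ℤ²_δ(f) = E_(1/2)[∏ over all interface loops u of δℤ² of 2cos(∫_(wind(u,·)≠0) f + π/3)] tends, as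
δ → 0⁺, to exp((3/4π²) ∬ log‖x−y‖ f(x) f(y) dx dy) (= exp(−σ²/2 ∬ G_ℝ² f f) with σ² = 3/π, G =
−(1/2π)log, cos_μ(x) = cos(x+π/3)/cos(π/3), μ = 1/6). Interior = points of non-zero winding number
(equals the interior of the rounded simple loop). Filed first per the plancard rule: the mechanism
rests on this unproved-in-Lean named fact; a cite request is filed; provers should not attempt it —
it lands as a Literature fact and is consumed as the first hypothesis of the assembly. [difficulty:
XL] -/
@[route_item "route-CriticalPhenomena-CardyMagicRigidity", crux]
def MagicFormulaZ2 : Prop :=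
  ∀ (f : ℂ → ℝ) (R C : ℝ), Measurable f → (∀ z, |f z| ≤ C) → (∀ z, R < ‖z‖ → f z = 0) → ∫ z, f z = 0 → Filter.Tendsto (fun δ : ℝ ↦ ∫ cfg, (∏ᶠ u ∈ ((Literature.Probability.Percolation.bondLoopConfig δ 0 cfg).F 0 ∪ (Literature.Probability.Percolation.bondLoopConfig δ 0 cfg).F 1), 2 * Real.cos ((∫ z in {z : ℂ | u.wind z ≠ 0}, f z) + Real.pi / 3)) ∂(Literature.Probability.Percolation.bondPercolation (Literature.Probability.LatticeModels.zdGraph 2) Literature.Probability.Percolation.half)) (nhdsWithin 0 (Set.Ioi 0)) (nhds (Real.exp (3 / (4 * Real.pi ^ 2) * ∫ x, ∫ y, Real.log ‖x - y‖ * f x * f y)))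

/-- item stmt-CriticalPhenomena-11206 · support · rank 9 · closed · proved by Summit.CriticalPhenomena.CardyFormulaZ2.Theorems.smirnovTri_proof @ f6eedcfa5718 (prover) · by planner
sources: Smirnov2001, BollobasRiordan2006, lean:Literature.Probability.Percolation.hasCrossingLimit_triDomainCrossingProb_holds
[support] Smirnov's theorem on the triangular lattice, in the tree's words: for every conformal
rectangle R, triDomainCrossingProb R δ → cardyFunction (crossRatio x) as δ → 0⁺ for every
uniformizing datum (φ, x). Definitionally the Literature fact
Literature.Probability.Percolation.hasCrossingLimit_triDomainCrossingProb (Smirnov 2001 Thm 1;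
Bollobás–Riordan 2006 Ch. 7 Thm 2), PROVED in the tree: close it in one line, `theorem smirnovTri :
SmirnovTri := Literature.Probability.Percolation.hasCrossingLimit_triDomainCrossingProb_holds`
(import Literature.Probability.Percolation.CardyFormulaConformalInvariance). Listed as an item (the
gate's fix for the former unlisted assembly hypothesis) instead of imported so that the route file
keeps the loop-vocabulary import closure. [difficulty: provable-now] -/
@[route_item "route-CriticalPhenomena-CardyMagicRigidity", crux]
def SmirnovTri : Prop :=
  ∀ R : Literature.Probability.RandomPlanarGeometry.ConformalRectangle, R.HasCrossingLimit (Literature.Probability.Percolation.triDomainCrossingProb R) Literature.Probability.RandomPlanarGeometry.cardyFunction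

-- `SmirnovTri` holds: proved by `Summit.CriticalPhenomena.CardyFormulaZ2.Theorems.smirnovTri_proof` @ f6eedcfa5718 (its module imports this route file, so no `_holds` link can be stated here).

/-- item stmt-CriticalPhenomena-14171 · support · rank 9 · closed · proved by Summit.CriticalPhenomena.CardyFormulaZ2.Theorems.loopLimitFromMagic_proof @ c628116390c3 (prover) · by planner
sources: arXiv:2603.06268, DKKMO2020Rotational
[support] Glue (target reachability, route-choice repair 2026-08-16): the target X = LoopLimitZ2EqT
is the conclusion of the rigidity crux applied to the two magic formulas — MagicFormulaZ2 →
MagicFormulaT → NestingRigidity → LoopLimitZ2EqT, stated over the route's own decl names.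
NestingRigidity is by definition (body of MagicFormulaZ2) → (body of MagicFormulaT) → (body of
LoopLimitZ2EqT), so this item is pure logic: close it in one line, `theorem loopLimitFromMagic :
LoopLimitFromMagic := fun h2 h4 h3 => h3 h2 h4` (checked in the planner sketch, lean rc 0). It
carries no mathematical content of its own; the content stays in NestingRigidity (rank 3),
MagicFormulaT (rank 4) and the input fact MagicFormulaZ2. The deciding theorem `closes` derives X
through this item and then CardyFormulaZ2 through LoopsToCrossings + SmirnovTri. [deps:
MagicFormulaZ2, MagicFormulaT, NestingRigidity, LoopLimitZ2EqT] [difficulty: provable-now] -/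
@[route_item "route-CriticalPhenomena-CardyMagicRigidity", crux]
def LoopLimitFromMagic : Prop :=
  MagicFormulaZ2 → MagicFormulaT → NestingRigidity → LoopLimitZ2EqT

-- `LoopLimitFromMagic` holds: proved by `Summit.CriticalPhenomena.CardyFormulaZ2.Theorems.loopLimitFromMagic_proof` @ c628116390c3 (its module imports this route file, so no `_holds` link can be stated here).

/-- item stmt-CriticalPhenomena-4838 · support · rank 9 · open · by planner
sources: arXiv:2603.06268, DKKMO2020Rotational
[support] The converse tool (arXiv:2603.06268 §5 p. 37 run between ℤ² and 𝕋): X → for every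
admissible f, Λ^ℤ²_δ(f) − Λ^𝕋_δ(f) → 0 ("restrict to big loops" with O(ε^c) error by RSW on both
lattices, uniform integrability of the unbounded product |∏| ≤ 2^N from super-exponential nesting
tails, then couple). With MagicFormulaZ2 it makes MagicFormulaT NECESSARY for X, so a refutation of
rank 4 refutes loop universality; it is also the continuity half of the foreseen split of rank 3.
[difficulty: M] -/
@[route_item "route-CriticalPhenomena-CardyMagicRigidity", crux]
def TransferContinuity : Prop :=
  (Filter.Tendsto (fun δ : ℝ ↦ Literature.Probability.RandomPlanarGeometry.LoopConfig.cnLawEDist (Literature.Probability.Percolation.bondPercolation (Literature.Probability.LatticeModels.zdGraph 2) Literature.Probability.Percolation.half) (Literature.Probability.Percolation.bondLoopConfig δ 0) (Literature.Probability.LatticeModels.triSitePercolation Literature.Probability.Percolation.half) (fun cfg ↦ (⟨fun i ↦ {u : Literature.Probability.RandomPlanarGeometry.UnbasedLoop ℂ | ∃ (v : Literature.Probability.LatticeModels.HexVertex) (γ : Literature.Probability.LatticeModels.hexGraph.Walk v v), Literature.Probability.Percolation.IsSiteInterfaceLoop cfg γ ∧ (i = 1 ↔ 0 < Literature.Probability.Percolation.shoelace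 (γ.support.map Literature.Probability.LatticeModels.hexCenter)) ∧ u = Literature.Probability.RandomPlanarGeometry.UnbasedLoop.mk (Literature.Probability.RandomPlanarGeometry.BasedLoop.mk (Literature.Probability.Percolation.siteLoopCurve δ γ) (Literature.Probability.Percolation.isLoop_siteLoopCurve δ γ))}⟩ : Literature.Probability.RandomPlanarGeometry.LoopConfig ℂ))) (nhdsWithin 0 (Set.Ioi 0)) (nhds 0)) → ∀ (f : ℂ → ℝ) (R C : ℝ), Measurable f → (∀ z, |f z| ≤ C) → (∀ z, R < ‖z‖ → f z = 0) → ∫ z, f z = 0 → Filter.Tendsto (fun δ : ℝ ↦ (fun δ : ℝ ↦ ∫ cfg, (∏ᶠ u ∈ ((Literature.Probability.Percolation.bondLoopConfig δ 0 cfg).F 0 ∪ (Literature.Probability.Percolation.bondLoopConfig δ 0 cfg).F 1), 2 * Real.cos ((∫ z in {z : ℂ | u.wind z ≠ 0}, f z) + Real.pi / 3)) ∂(Literature.Probability.Percolation.bondPercolation (Literature.Probability.LatticeModels.zdGraph 2) Literature.Probability.Percolation.half)) δ - (fun δ : ℝ ↦ ∫ cfg, (∏ᶠ u ∈ {u : Literature.Probability.RandomPlanarGeometry.UnbasedLoop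 ℂ | ∃ (v : Literature.Probability.LatticeModels.HexVertex) (γ : Literature.Probability.LatticeModels.hexGraph.Walk v v), Literature.Probability.Percolation.IsSiteInterfaceLoop cfg γ ∧ u = Literature.Probability.RandomPlanarGeometry.UnbasedLoop.mk (Literature.Probability.RandomPlanarGeometry.BasedLoop.mk (Literature.Probability.Percolation.siteLoopCurve δ γ) (Literature.Probability.Percolation.isLoop_siteLoopCurve δ γ))}, 2 * Real.cos ((∫ z in {z : ℂ | u.wind z ≠ 0}, f z) + Real.pi / 3)) ∂(Literature.Probability.LatticeModels.triSitePercolation Literature.Probability.Percolation.half)) δ) (nhdsWithin 0 (Set.Ioi 0)) (nhds 0)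

-- earlier Assembly (stmt-CriticalPhenomena-4839, replaced 2026-08-15T16:37:45Z -> stmt-CriticalPhenomena-11038): retired by None — MagicFormulaZ2 → MagicFormulaT → NestingRigidity → LoopsToCrossings → Literature.Probability.Percolation.hasCrossingLimit_triDomainCrossingProb → CardyFormulaZ2
/-- item stmt-CriticalPhenomena-11207 · assembly · rank 1 · closed · proved by Summit.CriticalPhenomena.CardyFormulaZ2.Theorems.cardyMagicRigidity_assembly_proof @ 074fd9a481a7 (prover) · by planner
sources: Smirnov2001, arXiv:2603.06268, CamiaNewman2006
[assembly] MagicFormulaZ2 → MagicFormulaT → NestingRigidity → LoopsToCrossings → SmirnovTri →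
CardyFormulaZ2 — over listed items only (Smirnov's theorem is the support item SmirnovTri, no longer
an unlisted Literature hypothesis). Pure logic + Mathlib, provable now exactly as the route's
deciding theorem `closes`: intro h2 h4 h3 h5 hS R φ x hux; key := (h5 (h3 h2 h4) R).add (hS R φ x
hux); simp only [sub_add_cancel, zero_add] at key; exact key. [difficulty: provable-now] -/
@[route_item "route-CriticalPhenomena-CardyMagicRigidity", crux]
def Assembly : Prop :=
  MagicFormulaZ2 → MagicFormulaT → NestingRigidity → LoopsToCrossings → SmirnovTri → _root_.CardyFormulaZ2

-- `Assembly` holds: proved by `Summit.CriticalPhenomena.CardyFormulaZ2.Theorems.cardyMagicRigidity_assembly_proof` @ 074fd9a481a7 (its module imports this route file, so no `_holds` link can be stated here).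

/-! D-0027 §2.1 — DECIDING THEOREM (planner-authored via `route open/edit --closes-file`; by planner-rchoice-CriticalPhenomena-CardyMagicRi-20956ac9-0 2026-08-16T03:14:36Z):
its hypotheses are this route's items and its conclusion the sub-problem Statement (glue_lint), and it elaborates with this file. -/

@[closes "route-CriticalPhenomena-CardyMagicRigidity"] theorem closes (h0 : LoopLimitZ2EqT) (h2 : MagicFormulaZ2) (h3 : NestingRigidity) (h4 : MagicFormulaT)
    (h5 : LoopsToCrossings) (h9 : TransferContinuity) (hS : SmirnovTri) (hA : Assembly)
    (hG : LoopLimitFromMagic) :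
    _root_.CardyFormulaZ2 := by
  -- D-0027 §2.1 deciding theorem of route CardyMagicRigidity (all nine items as hypotheses, route order;
  -- rev 2026-08-16 route-choice repair: the glue item LoopLimitFromMagic added as ninth hypothesis).
  -- Self-contained glue; the Assembly item `hA`, the target `h0` and the support `h9` are not invoked.
  -- X = LoopLimitZ2EqT is RE-DERIVED inside the route through the glue item LoopLimitFromMagic (hG)
  -- from the magic formula on ℤ² (h2), the magic formula on 𝕋 (h4) and nesting rigidity (h3):
  have hX : LoopLimitZ2EqT := hG h2 h4 h3
  -- X ⇒ crossing universality ℤ² ~ 𝕋 in every conformal rectangle (crux LoopsToCrossings):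
  have hdiff := h5 hX
  -- Smirnov's theorem on 𝕋 (support item SmirnovTri = the Literature fact
  -- `hasCrossingLimit_triDomainCrossingProb`, PROVED in the tree as `…_holds`; listed as an item so that the
  -- route file keeps the loop-vocabulary import closure) turns tri → F(η) into bond → F(η):
  intro R φ x hux
  have htri : Filter.Tendsto (Literature.Probability.Percolation.triDomainCrossingProb R)
      (nhdsWithin 0 (Set.Ioi 0))
      (nhds (Literature.Probability.RandomPlanarGeometry.cardyFunction
        (Literature.Probability.RandomPlanarGeometry.crossRatio x))) := hS R φ x hux
  have key := (hdiff R).add htri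
  simp only [sub_add_cancel, zero_add] at key
  exact key

end Summit.CriticalPhenomena.CardyFormulaZ2.Theses.CardyMagicRigidity
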